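import Mathlib.Analysis.SpecialFunctions.Pow.Asymptotics
import Literature.Computability.AlgebraicComplexity.FlatteningRank
import Literature.Barriers.MatrixMultiplication.UniversalMethodBarrierDegenerationPow
import Literature.Barriers.MatrixMultiplication.UniversalMethodBarrierProducts
import HarnessLib

/-!
# Asymptotic rank tools: `S ≤ ζ⁽¹⁾ ≤ R̃`, `S̃ ≤ R̃`, `R̃` under degenerations and powers — proved

Topic `Literature/Barriers/MatrixMultiplication`; part of the PROOF of `UniversalMethodBarrier`
(Alman 2021), milestone "Cor. 2.8": the properties of the asymptotic rank `R̃ = asymptoticRank`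
(`AsymptoticSpectrum.lean`, an infimum `inf_N R(t^{⊗(N+1)})^{1/(N+1)}`) that Alman uses in §2.4
("degenerations cannot increase the asymptotic rank", citing Bini) and in the proof of Thm. 2.7
(flattening lower bounds, `R̃ ≥ S̃`). Everything PROVED over a field; no Fekete lemma is needed
(all statements are inequalities in the direction an infimum gives for free, plus one limit
`(kMh+1)^{2/(kM)} → 1`).

## Content

* `sliceRank_le_flatteningRank` — `S(T) ≤ ζ⁽¹⁾(T)` (Alman Lemma 2.1(1), `S ≤ S_x`);
  `asymptoticRank_le_rpow` — `R̃(t) ≤ R(t^{⊗n})^{1/n}`; `flatteningRank_le_asymptoticRank` —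
  `ζ⁽¹⁾ ≤ R̃` (`ζ⁽¹⁾` multiplicative, `≤ R`); `asymptoticSliceRank_le_flatteningRank`,
  `asymptoticSliceRank_le_asymptoticRank` — **`S̃(T) ≤ R̃(T)`** for the supremum `S̃` as vendored.
* `tensorRank_le_of_isPolyDegen_unitTensor`, `tensorRank_le_of_isPolyDegen` — **border rank to
  rank at order `h`**: `R(s) ≤ (h+1)² R(t)` if `t ⊵ s` with order `h` (Bläser 2013, Lemma 6.4, with
  the cruder constant `(h+1)²` for `C(h+2,2)`: the `λ^h`-coefficient of a product of three
  polynomial vectors is a sum of `#{i+j+l=h}` triads); `isPolyDegen_zero_of_eq`, `IsPolyDegen.pow`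
  (`t ⊵_h s ⇒ t^{⊗N} ⊵_{Nh} s^{⊗N}`), `tensorRank_kroneckerPow_mul` (`R(t^{⊗Nn}) = R((t^{⊗n})^{⊗N})`).
* `rpow_tensorRank_pow_pow_le`, `asymptoticRank_kroneckerPow_le` — **`R̃(t^{⊗k}) ≤ R̃(t)^k`**;
  `asymptoticRank_le_of_polyDegeneratesTo` — **`t ⊵ s ⇒ R̃(s) ≤ R̃(t)`**
  (`R̃(s) ≤ ((kMh+1)²)^{1/(kM)} · R(t^{⊗M})^{1/M}` for all `k`, and the factor tends to `1`,
  `tendsto_rpow_div_mul_add`).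

## References

* J. Alman, Theory of Computing 17 (2021), §2.4, Lemma 2.1, proof of Thm. 2.9 (p. 14:
  "`R̃(T) ≥ S̃(T)`"). [Alman2021]
* M. Bläser, *Fast Matrix Multiplication* (2013), Lemma 6.4 (`R(t) ≤ c_h R_h(t)`). [Blaser2013]
* M. Christandl, P. Vrana, J. Zuiddam, JAMS 36 (2023), §1.1 (asymptotic rank). [ChristandlVranaZuiddam2023]
-/

noncomputable section

open scoped BigOperators Polynomial

namespace Literature.Barriers.MatrixMultiplication

open Literature.Computability.AlgebraicComplexity
open Filter Topology

universe u

/-! ## Slice rank, flattening rank, asymptotic rank -/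

section SliceFlattening

variable {K : Type u} [Field K]
variable {ι κ μ : Type*} [Fintype ι] [Fintype κ] [Fintype μ]

omit [Fintype ι] in
/-- **`S(T) ≤ ζ⁽¹⁾(T)`**: slice along a basis of the span of the `x`-slices (Alman 2021,
Lemma 2.1(1): `S(A) ≤ S_x(A)`, with `S_x = ζ⁽¹⁾`). [cite: Alman2021, Lemma 2.1] -/
theorem sliceRank_le_flatteningRank (t : ι → κ → μ → K) : sliceRank t ≤ flatteningRank t := by
  show sliceRank t ≤ Module.finrank K (Submodule.span K (Set.range (xSlices t)))
  set W := Submodule.span K (Set.range (xSlices t)) with hW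
  set b := Module.finBasis K W with hb
  have hmem : ∀ a, xSlices t a ∈ W := fun a => Submodule.subset_span ⟨a, rfl⟩
  have h := sliceRank_le_of_eq (t := t) (kx := Module.finrank K W) (ky := 0) (kz := 0)
    (fun i a => b.repr ⟨xSlices t a, hmem a⟩ i) (fun i bb cc => (b i : κ × μ → K) (bb, cc))
    Fin.elim0 Fin.elim0 Fin.elim0 Fin.elim0 ?_
  · simpa using h
  · funext a bb cc
    simp only [Finset.univ_eq_empty, Finset.sum_empty, add_zero]
    have := congrArg (fun w : W => (w : κ × μ → K) (bb, cc)) (b.sum_repr ⟨xSlices t a, hmem a⟩)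
    simp only [Submodule.coe_sum, Submodule.coe_smul, Finset.sum_apply, Pi.smul_apply,
      smul_eq_mul] at this
    exact this.symm

/-- `R̃(t) ≤ R(t^{⊗n})^{1/n}` for every `n ≥ 1` (definition of `R̃` as an infimum). [cite: ChristandlVranaZuiddam2023, §1.1] -/
theorem asymptoticRank_le_rpow (t : ι → κ → μ → K) {n : ℕ} (hn : 0 < n) :
    asymptoticRank t ≤ (tensorRank (kroneckerPow t n) : ℝ) ^ ((n : ℝ)⁻¹) := by
  obtain ⟨N, rfl⟩ : ∃ N, n = N + 1 := ⟨n - 1, by omega⟩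
  have hb : BddBelow (Set.range fun N : ℕ =>
      ((tensorRank (kroneckerPow t (N + 1)) : ℝ) ^ ((N : ℝ) + 1)⁻¹)) :=
    ⟨0, by rintro _ ⟨N, rfl⟩; positivity⟩
  refine (ciInf_le hb N).trans_eq ?_
  push_cast
  rfl

/-- **`ζ⁽¹⁾(T) ≤ R̃(T)`** (`ζ⁽¹⁾` is multiplicative and `≤ R`, so `ζ⁽¹⁾(T)^{n} ≤ R(T^{⊗n})`).
[cite: ChristandlVranaZuiddam2023, Example 1.4] -/
theorem flatteningRank_le_asymptoticRank (t : ι → κ → μ → K) :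
    (flatteningRank t : ℝ) ≤ asymptoticRank t := by
  refine le_ciInf fun N => ?_
  have h1 : ((flatteningRank t : ℝ)) ^ (N + 1) ≤ (tensorRank (kroneckerPow t (N + 1)) : ℝ) := by
    have := flatteningRank_le_tensorRank (kroneckerPow t (N + 1))
    rw [flatteningRank_kroneckerPow] at this
    exact_mod_cast this
  have hexp : ((N : ℝ) + 1)⁻¹ = (((N + 1 : ℕ) : ℝ))⁻¹ := by push_cast; ring
  calc (flatteningRank t : ℝ)
      = (((flatteningRank t : ℝ)) ^ (N + 1)) ^ ((N : ℝ) + 1)⁻¹ := by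
        rw [hexp, Real.pow_rpow_inv_natCast (Nat.cast_nonneg _) (Nat.succ_ne_zero N)]
    _ ≤ (tensorRank (kroneckerPow t (N + 1)) : ℝ) ^ ((N : ℝ) + 1)⁻¹ :=
        Real.rpow_le_rpow (by positivity) h1 (by positivity)

/-- **`S̃(T) ≤ ζ⁽¹⁾(T)`** (`S(T^{⊗n}) ≤ ζ⁽¹⁾(T^{⊗n}) = ζ⁽¹⁾(T)^n`). [cite: Alman2021, Lemma 2.1] -/
theorem asymptoticSliceRank_le_flatteningRank (t : ι → κ → μ → K) :
    asymptoticSliceRank t ≤ flatteningRank t := by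
  refine ciSup_le fun n => ?_
  have h1 : (sliceRank (kroneckerPow t (n + 1)) : ℝ) ≤ (flatteningRank t : ℝ) ^ (n + 1) := by
    have := sliceRank_le_flatteningRank (kroneckerPow t (n + 1))
    rw [flatteningRank_kroneckerPow] at this
    exact_mod_cast this
  have hexp : (1 / ((n : ℝ) + 1)) = (((n + 1 : ℕ) : ℝ))⁻¹ := by push_cast; ring
  calc ((sliceRank (kroneckerPow t (n + 1)) : ℝ) ^ (1 / ((n : ℝ) + 1)))
      ≤ ((flatteningRank t : ℝ) ^ (n + 1)) ^ (1 / ((n : ℝ) + 1)) :=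
        Real.rpow_le_rpow (Nat.cast_nonneg _) h1 (by positivity)
    _ = flatteningRank t := by
        rw [hexp, Real.pow_rpow_inv_natCast (Nat.cast_nonneg _) (Nat.succ_ne_zero n)]

/-- **`S̃(T) ≤ R̃(T)`** (Alman 2021, p. 14: "`R̃(T) ≥ S̃(T)`"). [cite: Alman2021, Thm. 2.9 (proof)] -/
theorem asymptoticSliceRank_le_asymptoticRank (t : ι → κ → μ → K) :
    asymptoticSliceRank t ≤ asymptoticRank t :=
  (asymptoticSliceRank_le_flatteningRank t).trans (flatteningRank_le_asymptoticRank t)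

end SliceFlattening

/-! ## Rank under a degeneration of order `h`; powers -/

section RankDegeneration

variable {K : Type u} [Field K]
variable {ι κ μ ι' κ' μ' : Type*} [Fintype ι] [Fintype κ] [Fintype μ] [Fintype ι'] [Fintype κ']
  [Fintype μ']

/-- Truncated range sums as indicator sums over a larger range. [folklore] -/
theorem sum_range_succ_eq_sum_range_ite {M : Type*} [AddCommMonoid M] (f : ℕ → M) {m h : ℕ}
    (hm : m ≤ h) : ∑ i ∈ Finset.range (m + 1), f i =
      ∑ i ∈ Finset.range (h + 1), if i ≤ m then f i else 0 := by
  rw [← Finset.sum_filter]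
  congr 1
  ext i
  simp only [Finset.mem_range, Finset.mem_filter]
  omega

omit [Fintype ι'] [Fintype κ'] [Fintype μ'] in
/-- **Border rank to rank, order `h`** (Bläser 2013, Lemma 6.4, with the crude constant `(h+1)²`
in place of `C(h+2,2)`): if `(A,B,C)` is a degeneration of order `h` from `⟨r⟩` to `s`, then
`R(s) ≤ r (h+1)²` — the `λ^h`-coefficient of `Σ_ρ (A e_ρ)(B e_ρ)(C e_ρ)` is a sum of
`r · #{i + j + l = h}` triads. [cite: Blaser2013, Lemma 6.4] -/
theorem tensorRank_le_of_isPolyDegen_unitTensor {r h : ℕ} {s : ι' → κ' → μ' → K}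
    {A : Fin r → ι' → K[X]} {B : Fin r → κ' → K[X]} {C : Fin r → μ' → K[X]}
    (hd : IsPolyDegen h (unitTensor K r) s A B C) : tensorRank s ≤ r * ((h + 1) * (h + 1)) := by
  classical
  have hcard : Fintype.card (Fin r × Fin (h + 1) × Fin (h + 1)) = r * ((h + 1) * (h + 1)) := by
    simp [Fintype.card_prod, Fintype.card_fin]
  rw [← hcard]
  refine tensorRank_le_card_of_eq_sum
    (fun σ a' => if ((σ.2.2 : ℕ)) ≤ σ.2.1 then (A σ.1 a').coeff σ.2.2 else 0)
    (fun σ b' => (B σ.1 b').coeff (σ.2.1 - σ.2.2)) (fun σ c' => (C σ.1 c').coeff (h - σ.2.1)) ?_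
  funext a' b' c'
  -- `s = [λ^h] Σ_ρ A_ρ B_ρ C_ρ`
  have hs : s a' b' c' = (∑ ρ, A ρ a' * B ρ b' * C ρ c').coeff h := by
    have := hd a' b' c' h le_rfl
    rw [if_pos rfl] at this
    rw [← this]
    congr 1
    simp only [polySubst, unitTensor_apply]
    rw [← sum_sum_sum_ite_eq_eq (fun i j l => A i a' * B j b' * C l c')]
    refine Finset.sum_congr rfl fun i _ => Finset.sum_congr rfl fun j _ =>
      Finset.sum_congr rfl fun l _ => ?_
    split_ifs <;> simp
  rw [hs, Finset.sum_apply, Finset.sum_apply, Finset.sum_apply, Polynomial.finsetSum_coeff,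
    Fintype.sum_prod_type]
  refine Finset.sum_congr rfl fun ρ _ => ?_
  rw [Fintype.sum_prod_type]
  simp only [triad_apply]
  rw [Polynomial.coeff_mul, Finset.Nat.sum_antidiagonal_eq_sum_range_succ_mk, Finset.sum_range]
  refine Finset.sum_congr rfl fun m _ => ?_
  have hm' : (m : ℕ) ≤ h := Nat.lt_succ_iff.1 m.isLt
  rw [Polynomial.coeff_mul, Finset.Nat.sum_antidiagonal_eq_sum_range_succ_mk, Finset.sum_mul,
    sum_range_succ_eq_sum_range_ite _ hm', Finset.sum_range]
  refine Finset.sum_congr rfl fun i _ => ?_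
  split_ifs <;> simp

omit [Fintype ι'] [Fintype κ'] [Fintype μ'] in
/-- **Rank of an order-`h` degeneration**: `R(s) ≤ (h+1)² R(t)` if `t ⊵ s` with order `h`
(`t ≤ ⟨R(t)⟩`, then the previous lemma). [cite: Blaser2013, Lemma 6.4] -/
theorem tensorRank_le_of_isPolyDegen {h : ℕ} {t : ι → κ → μ → K} {s : ι' → κ' → μ' → K}
    {A : ι → ι' → K[X]} {B : κ → κ' → K[X]} {C : μ → μ' → K[X]} (hd : IsPolyDegen h t s A B C) :
    tensorRank s ≤ (h + 1) * (h + 1) * tensorRank t := by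
  obtain ⟨A₀, B₀, C₀, ht⟩ := tensorRestrictsTo_unitTensor_of_tensorRank_le t le_rfl
  have := tensorRank_le_of_isPolyDegen_unitTensor (hd.restrict_left A₀ B₀ C₀ ht)
  rw [mul_comm] at this
  exact this

omit [Fintype ι'] [Fintype κ'] [Fintype μ'] in
/-- A restriction is a degeneration of order `0` (explicit maps). [cite: Alman2021, §2.4] -/
theorem isPolyDegen_zero_of_eq {t : ι → κ → μ → K} {s : ι' → κ' → μ' → K} (A : ι' → ι → K)
    (B : κ' → κ → K) (C : μ' → μ → K)
    (hs : ∀ a' b' c', s a' b' c' = ∑ a, ∑ b, ∑ c, A a' a * B b' b * C c' c * t a b c) :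
    IsPolyDegen 0 t s (fun a a' => Polynomial.C (A a' a)) (fun b b' => Polynomial.C (B b' b))
      (fun c c' => Polynomial.C (C c' c)) := by
  intro a' b' c' j hj
  obtain rfl : j = 0 := Nat.le_zero.1 hj
  rw [if_pos rfl, hs]
  simp only [polySubst, Polynomial.finsetSum_coeff, ← Polynomial.C_mul, Polynomial.coeff_C_zero]
  exact Finset.sum_congr rfl fun a _ => Finset.sum_congr rfl fun b _ =>
    Finset.sum_congr rfl fun c _ => by ring

/-- **Powers of a degeneration, with orders**: `t ⊵_h s ⇒ t^{⊗N} ⊵_{Nh} s^{⊗N}`.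
[cite: Alman2021, §2.4] -/
theorem IsPolyDegen.pow [DecidableEq ι] [DecidableEq κ] [DecidableEq μ] [DecidableEq ι']
    [DecidableEq κ'] [DecidableEq μ'] {h : ℕ} {t : ι → κ → μ → K} {s : ι' → κ' → μ' → K}
    {A : ι → ι' → K[X]} {B : κ → κ' → K[X]} {C : μ → μ' → K[X]} (hd : IsPolyDegen h t s A B C)
    (N : ℕ) : ∃ (A' : (Fin N → ι) → (Fin N → ι') → K[X]) (B' : (Fin N → κ) → (Fin N → κ') → K[X])
      (C' : (Fin N → μ) → (Fin N → μ') → K[X]),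
      IsPolyDegen (N * h) (kroneckerPow t N) (kroneckerPow s N) A' B' C' := by
  induction N with
  | zero =>
    refine ⟨fun a a' => Polynomial.C ((fun _ _ => (1 : K)) a' a),
      fun b b' => Polynomial.C ((fun _ _ => (1 : K)) b' b),
      fun c c' => Polynomial.C ((fun _ _ => (1 : K)) c' c), ?_⟩
    rw [Nat.zero_mul]
    refine isPolyDegen_zero_of_eq (fun _ _ => 1) (fun _ _ => 1) (fun _ _ => 1) fun a' b' c' => ?_
    simp [kroneckerPow_apply]
  | succ N ih =>
    obtain ⟨A', B', C', hN⟩ := ih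
    obtain ⟨A₁, B₁, C₁, h1⟩ :=
      (show TensorRestrictsTo (kroneckerPow t (N + 1)) (kroneckerTensor t (kroneckerPow t N)) by
        rw [kroneckerTensor_kroneckerPow_eq]; exact tensorRestrictsTo_precomp _ _ _ _)
    obtain ⟨A₃, B₃, C₃, h3⟩ :=
      (show TensorRestrictsTo (kroneckerTensor s (kroneckerPow s N)) (kroneckerPow s (N + 1)) by
        rw [kroneckerPow_succ_eq s N]; exact tensorRestrictsTo_precomp _ _ _ _)
    have h2 := ((hd.kronecker hN).restrict_left A₁ B₁ C₁ h1).restrict_right A₃ B₃ C₃ h3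
    rw [show h + N * h = (N + 1) * h by ring] at h2
    exact ⟨_, _, _, h2⟩

omit [Fintype ι] [Fintype κ] [Fintype μ] in
/-- `R(t^{⊗(Nn)}) = R((t^{⊗n})^{⊗N})` (relabelling). [folklore] -/
theorem tensorRank_kroneckerPow_mul (t : ι → κ → μ → K) (N n : ℕ) :
    tensorRank (kroneckerPow t (N * n)) = tensorRank (kroneckerPow (kroneckerPow t n) N) := by
  have key : kroneckerPow t (N * n) = fun a b c => kroneckerPow (kroneckerPow t n) N
      (((Equiv.arrowCongr finProdFinEquiv.symm (Equiv.refl ι)).trans (Equiv.curry _ _ _)) a)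
      (((Equiv.arrowCongr finProdFinEquiv.symm (Equiv.refl κ)).trans (Equiv.curry _ _ _)) b)
      (((Equiv.arrowCongr finProdFinEquiv.symm (Equiv.refl μ)).trans (Equiv.curry _ _ _)) c) := by
    funext a b c
    simp only [kroneckerPow_apply, Equiv.trans_apply, Equiv.arrowCongr_apply, Equiv.coe_refl,
      Equiv.curry_apply, Function.curry_apply, Function.comp_apply, Equiv.symm_symm, id_eq]
    rw [← Fintype.prod_prod_type' (f := fun i j => t (a (finProdFinEquiv (i, j)))
      (b (finProdFinEquiv (i, j))) (c (finProdFinEquiv (i, j))))]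
    exact (Fintype.prod_equiv finProdFinEquiv _ _ fun x => rfl).symm
  rw [key, tensorRank_reindex]

end RankDegeneration

/-! ## `R̃` under powers and degenerations -/

section AsymptoticRank

variable {K : Type u} [Field K]
variable {ι κ μ ι' κ' μ' : Type*} [Fintype ι] [Fintype κ] [Fintype μ] [Fintype ι'] [Fintype κ']
  [Fintype μ'] [DecidableEq ι] [DecidableEq κ] [DecidableEq μ] [DecidableEq ι'] [DecidableEq κ']
  [DecidableEq μ']

omit [DecidableEq ι] [DecidableEq κ] [DecidableEq μ] in
/-- `R((t^{⊗k})^{⊗J})^{1/J} ≤ (R(t^{⊗J})^{1/J})^k`: relabel `(t^{⊗k})^{⊗J} ≅ (t^{⊗J})^{⊗k}` and use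
submultiplicativity of `R`. [folklore] -/
theorem rpow_tensorRank_pow_pow_le (t : ι → κ → μ → K) (k : ℕ) {J : ℕ} (hJ : 0 < J) :
    ((tensorRank (kroneckerPow (kroneckerPow t k) J) : ℝ) ^ ((J : ℝ)⁻¹)) ≤
      ((tensorRank (kroneckerPow t J) : ℝ) ^ ((J : ℝ)⁻¹)) ^ k := by
  have h1 : tensorRank (kroneckerPow (kroneckerPow t k) J) ≤ tensorRank (kroneckerPow t J) ^ k := by
    rw [← tensorRank_kroneckerPow_mul, mul_comm, tensorRank_kroneckerPow_mul]
    exact tensorRank_kroneckerPow_le _ k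
  have h2 : ((tensorRank (kroneckerPow (kroneckerPow t k) J) : ℝ)) ≤
      ((tensorRank (kroneckerPow t J) : ℝ)) ^ k := by exact_mod_cast h1
  calc ((tensorRank (kroneckerPow (kroneckerPow t k) J) : ℝ) ^ ((J : ℝ)⁻¹))
      ≤ (((tensorRank (kroneckerPow t J) : ℝ)) ^ k) ^ ((J : ℝ)⁻¹) :=
        Real.rpow_le_rpow (Nat.cast_nonneg _) h2 (by positivity)
    _ = ((tensorRank (kroneckerPow t J) : ℝ) ^ ((J : ℝ)⁻¹)) ^ k := by
        rw [← Real.rpow_natCast, ← Real.rpow_mul (Nat.cast_nonneg _), mul_comm,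
          Real.rpow_mul (Nat.cast_nonneg _), Real.rpow_natCast]

omit [DecidableEq ι] [DecidableEq κ] [DecidableEq μ] in
/-- **`R̃(t^{⊗k}) ≤ R̃(t)^k`** (`k ≥ 1`; in fact equality, by Fekete). [cite: ChristandlVranaZuiddam2023, §1.1] -/
theorem asymptoticRank_kroneckerPow_le (t : ι → κ → μ → K) {k : ℕ} (hk : 0 < k) :
    asymptoticRank (kroneckerPow t k) ≤ asymptoticRank t ^ k := by
  have hk0 : (k : ℝ) ≠ 0 := by exact_mod_cast hk.ne'
  have h0 : 0 ≤ asymptoticRank (kroneckerPow t k) := asymptoticRank_nonneg _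
  -- `R̃(t^k)^{1/k} ≤ R(t^{⊗(N+1)})^{1/(N+1)}` for every `N`
  have key : asymptoticRank (kroneckerPow t k) ^ ((k : ℝ)⁻¹) ≤ asymptoticRank t := by
    refine le_ciInf fun N => ?_
    have h1 := asymptoticRank_le_rpow (kroneckerPow t k) (Nat.succ_pos N)
    have h2 := rpow_tensorRank_pow_pow_le t k (Nat.succ_pos N)
    have hexp : ((N : ℝ) + 1)⁻¹ = (((N + 1 : ℕ) : ℝ))⁻¹ := by push_cast; ring
    rw [hexp]
    calc asymptoticRank (kroneckerPow t k) ^ ((k : ℝ)⁻¹)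
        ≤ (((tensorRank (kroneckerPow t (N + 1)) : ℝ) ^ (((N + 1 : ℕ) : ℝ))⁻¹) ^ k) ^ ((k : ℝ)⁻¹) :=
          Real.rpow_le_rpow h0 (h1.trans h2) (by positivity)
      _ = (tensorRank (kroneckerPow t (N + 1)) : ℝ) ^ (((N + 1 : ℕ) : ℝ))⁻¹ :=
          Real.pow_rpow_inv_natCast (by positivity) hk.ne'
  calc asymptoticRank (kroneckerPow t k)
      = (asymptoticRank (kroneckerPow t k) ^ ((k : ℝ)⁻¹)) ^ k := by
        rw [Real.rpow_inv_natCast_pow h0 hk.ne']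
    _ ≤ asymptoticRank t ^ k := pow_le_pow_left₀ (by positivity) key k

/-- **`R̃` is monotone under degeneration**: `t ⊵ s ⇒ R̃(s) ≤ R̃(t)` (Alman 2021, §2.4:
"degenerations cannot increase the asymptotic rank of a tensor", citing Bini; here from
`R(s^{⊗n}) ≤ (nh+1)² R(t^{⊗n})` and `(nh+1)^{2/n} → 1`). [cite: Alman2021, §2.4] -/
theorem asymptoticRank_le_of_polyDegeneratesTo {t : ι → κ → μ → K} {s : ι' → κ' → μ' → K}
    (hts : PolyDegeneratesTo t s) : asymptoticRank s ≤ asymptoticRank t := by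
  obtain ⟨h, A, B, C, hd⟩ := hts
  refine le_ciInf fun m => ?_
  set M := m + 1 with hM
  set x : ℝ := ((tensorRank (kroneckerPow t M) : ℝ)) ^ ((M : ℝ)⁻¹) with hx
  have hx0 : 0 ≤ x := by positivity
  have hexp : ((m : ℝ) + 1)⁻¹ = ((M : ℝ))⁻¹ := by rw [hM]; push_cast; ring
  rw [hexp]
  change asymptoticRank s ≤ x
  -- for every `k ≥ 1`: `R̃(s) ≤ ((kMh+1)²)^{1/(kM)} · x`
  have key : ∀ k : ℕ, 0 < k →
      asymptoticRank s ≤ (((k * M * h + 1 : ℕ) : ℝ) ^ 2) ^ (((k * M : ℕ) : ℝ)⁻¹) * x := by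
    intro k hk
    have hkM : 0 < k * M := Nat.mul_pos hk (Nat.succ_pos m)
    obtain ⟨A', B', C', hpow⟩ := IsPolyDegen.pow hd (k * M)
    have h1 := asymptoticRank_le_rpow s hkM
    have h2 : tensorRank (kroneckerPow s (k * M)) ≤
        (k * M * h + 1) * (k * M * h + 1) * tensorRank (kroneckerPow t M) ^ k := by
      refine (tensorRank_le_of_isPolyDegen hpow).trans ?_
      refine Nat.mul_le_mul le_rfl ?_
      rw [tensorRank_kroneckerPow_mul]
      exact tensorRank_kroneckerPow_le _ k
    have h3 : ((tensorRank (kroneckerPow s (k * M)) : ℝ)) ≤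
        (((k * M * h + 1 : ℕ) : ℝ) ^ 2) * ((tensorRank (kroneckerPow t M) : ℝ)) ^ k := by
      have := (Nat.cast_le (α := ℝ)).2 h2
      push_cast at this ⊢
      nlinarith [this]
    calc asymptoticRank s ≤ ((tensorRank (kroneckerPow s (k * M)) : ℝ)) ^ (((k * M : ℕ) : ℝ)⁻¹) := h1
      _ ≤ ((((k * M * h + 1 : ℕ) : ℝ) ^ 2) * ((tensorRank (kroneckerPow t M) : ℝ)) ^ k) ^
            (((k * M : ℕ) : ℝ)⁻¹) := Real.rpow_le_rpow (Nat.cast_nonneg _) h3 (by positivity)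
      _ = (((k * M * h + 1 : ℕ) : ℝ) ^ 2) ^ (((k * M : ℕ) : ℝ)⁻¹) * x := by
          rw [Real.mul_rpow (by positivity) (by positivity)]
          congr 1
          rw [hx, ← Real.rpow_natCast ((tensorRank (kroneckerPow t M) : ℝ)) k,
            ← Real.rpow_mul (Nat.cast_nonneg _)]
          congr 1
          have hM0 : (M : ℝ) ≠ 0 := by rw [hM]; positivity
          have hk0 : (k : ℝ) ≠ 0 := by exact_mod_cast hk.ne'
          push_cast
          field_simp
  -- the factor `((kMh+1)²)^{1/(kM)}` tends to `1`
  have hlim : Tendsto (fun k : ℕ => (((k * M * h + 1 : ℕ) : ℝ) ^ 2) ^ (((k * M : ℕ) : ℝ)⁻¹) * x)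
      atTop (𝓝 (1 * x)) := by
    refine Tendsto.mul_const x ?_
    rcases Nat.eq_zero_or_pos h with hh | hh
    · subst hh
      simp only [mul_zero, zero_add, Nat.cast_one, one_pow, Real.one_rpow]
      exact tendsto_const_nhds
    -- `y ↦ y^{2h/(y-1)}` along `y_k = kMh + 1 → ∞`
    have hg := tendsto_rpow_div_mul_add (2 * h) 1 (-1) (by norm_num)
    have hy : Tendsto (fun k : ℕ => ((k * M * h + 1 : ℕ) : ℝ)) atTop atTop := by
      refine tendsto_natCast_atTop_atTop.comp ?_
      refine Filter.tendsto_atTop_mono (fun k => ?_) tendsto_id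
      have : 1 ≤ M * h := Nat.mul_pos (Nat.succ_pos m) hh
      simp only [id_eq]
      nlinarith
    refine (hg.comp hy).congr' ?_
    filter_upwards [Filter.eventually_gt_atTop 0] with k hk
    simp only [Function.comp_apply]
    rw [← Real.rpow_natCast _ 2, ← Real.rpow_mul (Nat.cast_nonneg _)]
    congr 1
    have hM0 : (M : ℝ) ≠ 0 := by rw [hM]; positivity
    have hk0 : (k : ℝ) ≠ 0 := by exact_mod_cast hk.ne'
    have hh0 : (h : ℝ) ≠ 0 := by exact_mod_cast hh.ne'
    push_cast
    field_simp
    ring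
  rw [one_mul] at hlim
  refine ge_of_tendsto hlim ?_
  filter_upwards [Filter.eventually_gt_atTop 0] with k hk
  exact key k hk

end AsymptoticRank



end Literature.Barriers.MatrixMultiplication

end
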